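import Literature.NumberTheory.Automorphic.GJUnfoldingData
import Literature.NumberTheory.Automorphic.GLnCuspidalSpectrumSiegel
import Literature.NumberTheory.Automorphic.IdeleNormDetGL
import Mathlib.Analysis.SpecialFunctions.Trigonometric.Bounds

/-!
# Route `DedekindQuotient1951` (Langlands) — support `PartialLEntire` (stmt-Langlands-17273):
# unfolding data at an `S`-good level and positivity of the local zeta integral at complex points

Helper file for the Godement–Jacquet unfolding with `T = S` (entire continuation of `L^S`).
Two refinements of the bricks of `GJUnfoldingData`:

* `exists_unfolding_data_of_level` — the data `𝔫, T = T(𝔫), Φ_∞, N` of `exists_unfolding_data`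
  adapted to a vector `φ ≠ 0` FIXED by `K(𝔫₀)`: the level is `𝔫 = 𝔫₀ · ∏_{w ∈ S} 𝔭_w`, so that
  `T(𝔫) = S ∪ {w ∣ 𝔫₀}` exactly (no auxiliary level enters: the finite part of the support of the
  test function lies in `K(𝔫) ≤ K(𝔫₀)`, which does not move `φ`), and the archimedean bump is
  supported where moreover `|t · log |det a|_𝔸| < 1` for a prescribed real `t`.
* `re_placesZeta_pos_of_im_eq` — for such data `Re Z_T(s) > 0` at EVERY `s` with `im s = t` (not only
  at real points, `re_placesZeta_pos`): on the support `Re ⟪φ, R(a) φ⟫ |det a|^{s}` has the sign of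
  `cos (t log |det a|) - 1/2 > 0`.
-/

set_option linter.dupNamespace false

noncomputable section

open scoped MatrixGroups NNReal Topology Classical InnerProductSpace Pointwise
open NumberField NumberField.mixedEmbedding IsDedekindDomain MeasureTheory Filter Topology
open Literature.NumberTheory.Automorphic

namespace Summit.Langlands.Langlands.Theorems.DedekindQuotient1951

section Data

variable {n : ℕ} {K : Type} [Field K] [NumberField K]

/-- The primes of `𝔫₀ · 1 · ∏_{w ∈ S} 𝔭_w` lie in `S` or divide `𝔫₀`. [folklore] -/
theorem mem_or_dvd_of_mem_primesOf_mul_one_mul_prod {𝔫₀ : Ideal (𝓞 K)}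
    (S : Finset (HeightOneSpectrum (𝓞 K))) (h : 𝔫₀ * 1 * ∏ w ∈ S, w.asIdeal ≠ 0)
    {w : HeightOneSpectrum (𝓞 K)} (hw : w ∈ primesOf h) : w ∈ S ∨ w.asIdeal ∣ 𝔫₀ := by
  rw [mem_primesOf_iff, mul_one, Ideal.dvd_iff_le, Ideal.IsPrime.mul_le w.isPrime] at hw
  rcases hw with h0 | hS
  · exact Or.inr (Ideal.dvd_iff_le.2 h0)
  · obtain ⟨v, hvS, hv⟩ := (Ideal.IsPrime.prod_le w.isPrime).1 hS
    have hvw : v.asIdeal = w.asIdeal := v.isMaximal.eq_of_le w.isPrime.ne_top hv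
    have : v = w := HeightOneSpectrum.ext hvw
    exact Or.inl (this ▸ hvS)

variable {μ : Measure (AdelicGroupData.gl n K).automorphicQuotient}
  [(AdelicGroupData.gl n K).IsAutomorphicMeasure μ]

/-- `|det k|_𝔸 = 1` on a principal congruence subgroup `K(𝔫₀)`, `𝔫₀ ≠ 0` (the image of the compact
`K_f(𝔫₀)` under `GLn.ofFinite`, on which the idelic norm of the determinant is trivial,
`ideleNorm_det_ofFinite_eq_one_of_isCompact`). [folklore] -/
theorem adelicAbsDet_eq_one_of_mem_principalCongruenceLevel {𝔫₀ : Ideal (𝓞 K)} (h𝔫₀ : 𝔫₀ ≠ 0)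
    {k : GL (Fin n) (AdeleRing (𝓞 K) K)} (hk : k ∈ principalCongruenceLevel n K 𝔫₀) :
    adelicAbsDet n K k = 1 := by
  rw [← map_ofFinite_finitePrincipalCongruenceLevel n K 𝔫₀] at hk
  obtain ⟨u, hu, rfl⟩ := Subgroup.mem_map.1 hk
  rw [adelicAbsDet_apply]
  exact ideleNorm_det_ofFinite_eq_one_of_isCompact n K (isCompact_finitePrincipalCongruenceLevel n K h𝔫₀) hu

/-- **The data of the unfolding at the level of `φ`.** Given `0 ≠ φ` fixed by `K(𝔫₀)` (`𝔫₀ ≠ 0`), a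
finite set `S` of places and a real `t`, there are the level `𝔫 = 𝔫₀ · ∏_{w ∈ S} 𝔭_w ≤ 𝔫₀` — whose
primes `T = T(𝔫)` are exactly `S` together with the primes of `𝔫₀` — an archimedean bump `Φ_∞`
(values in `[0,1]`, `Φ_∞(1) = 1`) and a compact `N ⊆ GL_n(𝔸_K)` such that the `G_T`-part `Φ_G` of the
test function `Φ_∞ ⊗ 1_{B(𝔫)}` vanishes at every `a ∈ G_T` outside `N`, or with
`‖R(a) φ - φ‖ ≥ ‖φ‖/2`, or with `|t · log |det a|_𝔸| ≥ 1`. (Where `Φ_G(a) ≠ 0`, `a = a_∞ · (1, a_f)`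
with `(1, a_f) ∈ K(𝔫) ≤ K(𝔫₀)` fixing `φ` and of determinant of norm `1`, and `a_∞` in a prescribed
neighbourhood of `1`, `exists_isOpen_subset_preimage_ofInfinite`.) [folklore] -/
theorem exists_unfolding_data_of_level (S : Finset (HeightOneSpectrum (𝓞 K)))
    {φ : (AdelicGroupData.gl n K).L2 μ} (hφ0 : φ ≠ 0) {𝔫₀ : Ideal (𝓞 K)} (h𝔫₀ : 𝔫₀ ≠ 0)
    (hφfix : ∀ u ∈ principalCongruenceLevel n K 𝔫₀, (AdelicGroupData.gl n K).rightRegular μ u φ = φ)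
    (t : ℝ) :
    ∃ (𝔫 : Ideal (𝓞 K)) (h𝔫 : 𝔫 ≠ 0) (Φinf : SchwartzMap (Fin n → Fin n → mixedSpace K) ℂ)
      (N : Set (GL (Fin n) (AdeleRing (𝓞 K) K))),
      S ⊆ primesOf h𝔫 ∧ (∀ w : HeightOneSpectrum (𝓞 K), w.asIdeal ∣ 𝔫₀ → w ∈ primesOf h𝔫) ∧
      (∀ w ∈ primesOf h𝔫, w ∈ S ∨ w.asIdeal ∣ 𝔫₀) ∧ 𝔫 ≤ 𝔫₀ ∧
      (∀ x, ∃ r : ℝ, 0 ≤ r ∧ r ≤ 1 ∧ Φinf x = r) ∧ Φinf (1 : Matrix (Fin n) (Fin n) (mixedSpace K)) = 1 ∧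
      IsCompact N ∧
      ∀ a : placesFactor K n (primesOf h𝔫),
        gjTestFunctionG n K Φinf 𝔫 (a : GL (Fin n) (AdeleRing (𝓞 K) K)) ≠ 0 →
        (a : GL (Fin n) (AdeleRing (𝓞 K) K)) ∈ N ∧
          ‖(AdelicGroupData.gl n K).rightRegular μ (a : GL (Fin n) (AdeleRing (𝓞 K) K)) φ - φ‖ < ‖φ‖ / 2 ∧
          |t * Real.log (adelicAbsDet n K (a : GL (Fin n) (AdeleRing (𝓞 K) K)) : ℝ)| < 1 := by
  haveI : LocallyCompactSpace (GL (Fin n) (AdeleRing (𝓞 K) K)) :=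
    AdelicGroupData.locallyCompactSpace_gl_adelic_holds n K
  -- a compact neighbourhood of `1`
  obtain ⟨N', hN', hN'1⟩ := exists_compact_mem_nhds (1 : GL (Fin n) (AdeleRing (𝓞 K) K))
  -- the neighbourhood where `R(g) φ` is close to `φ`
  set U₀ : Set (GL (Fin n) (AdeleRing (𝓞 K) K)) :=
    {g | ‖(AdelicGroupData.gl n K).rightRegular μ g φ - φ‖ < ‖φ‖ / 2} with hU₀def
  have hU₀ : U₀ ∈ 𝓝 (1 : GL (Fin n) (AdeleRing (𝓞 K) K)) := by
    have hc : Continuous fun g : GL (Fin n) (AdeleRing (𝓞 K) K) =>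
        ‖(AdelicGroupData.gl n K).rightRegular μ g φ - φ‖ :=
      (((AdelicGroupData.gl n K).isStronglyContinuous_rightRegular_holds μ φ).sub continuous_const).norm
    refine (isOpen_lt hc continuous_const).mem_nhds ?_
    change ‖(AdelicGroupData.gl n K).rightRegular μ (1 : GL (Fin n) (AdeleRing (𝓞 K) K)) φ - φ‖ < ‖φ‖ / 2
    rw [rightRegular_one_apply, sub_self, norm_zero]
    exact half_pos (norm_pos_iff.2 hφ0)
  -- the neighbourhood where `|t log |det g|| < 1`
  set U₁ : Set (GL (Fin n) (AdeleRing (𝓞 K) K)) :=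
    {g | |t * Real.log (adelicAbsDet n K g : ℝ)| < 1} with hU₁def
  have hU₁ : U₁ ∈ 𝓝 (1 : GL (Fin n) (AdeleRing (𝓞 K) K)) := by
    have hc : Continuous fun g : GL (Fin n) (AdeleRing (𝓞 K) K) => |t * Real.log (adelicAbsDet n K g : ℝ)| :=
      (continuous_const.mul (continuous_adelicAbsDet.log fun g => (adelicAbsDet_pos g).ne')).abs
    refine (isOpen_lt hc continuous_const).mem_nhds ?_
    change |t * Real.log (adelicAbsDet n K (1 : GL (Fin n) (AdeleRing (𝓞 K) K)) : ℝ)| < 1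
    rw [map_one, NNReal.coe_one, Real.log_one, mul_zero, abs_zero]
    exact one_pos
  obtain ⟨V, hV, h1V, hVU⟩ :=
    exists_isOpen_subset_preimage_ofInfinite n K (Filter.inter_mem hN'1 (Filter.inter_mem hU₀ hU₁))
  obtain ⟨Φinf, hΦ01, hΦ1, hΦV⟩ := exists_schwartz_bump_mixedSpace hV h1V
  obtain ⟨h𝔫, hS, hT, hle₀, -⟩ := primesOf_mul_prod h𝔫₀ (one_ne_zero : (1 : Ideal (𝓞 K)) ≠ 0) S
  refine ⟨_, h𝔫, Φinf, N' * (principalCongruenceLevel n K 𝔫₀ : Set (GL (Fin n) (AdeleRing (𝓞 K) K))),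
    hS, hT, fun w hw => mem_or_dvd_of_mem_primesOf_mul_one_mul_prod S h𝔫 hw, hle₀, hΦ01, hΦ1,
    hN'.mul (isCompact_principalCongruenceLevel n K h𝔫₀), fun a ha => ?_⟩
  obtain ⟨haV, haK⟩ := gjTestFunctionG_ne_zero_imp hΦV h𝔫 a ha
  set x : GL (Fin n) (AdeleRing (𝓞 K) K) :=
    GLn.ofInfinite n K (GLn.toMixed n K (a : GL (Fin n) (AdeleRing (𝓞 K) K))) with hxdef
  set k : GL (Fin n) (AdeleRing (𝓞 K) K) :=
    GLn.ofFinite n K (GLn.sndHom n K (a : GL (Fin n) (AdeleRing (𝓞 K) K))) with hkdef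
  have hxU : x ∈ N' ∩ (U₀ ∩ U₁) := hVU _ haV
  have hk₀ : k ∈ principalCongruenceLevel n K 𝔫₀ := principalCongruenceLevel_mono n K h𝔫 hle₀ haK
  have hak : (a : GL (Fin n) (AdeleRing (𝓞 K) K)) = x * k :=
    (GLn.ofInfinite_toMixed_mul_ofFinite_sndHom _).symm
  refine ⟨?_, ?_, ?_⟩
  · rw [hak]
    exact Set.mul_mem_mul hxU.1 hk₀
  · have h2 : ‖(AdelicGroupData.gl n K).rightRegular μ x φ - φ‖ < ‖φ‖ / 2 := hxU.2.1
    rw [hak, rightRegular_mul_apply, hφfix k hk₀]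
    exact h2
  · have h3 : |t * Real.log (adelicAbsDet n K x : ℝ)| < 1 := hxU.2.2
    rw [hak, map_mul, adelicAbsDet_eq_one_of_mem_principalCongruenceLevel h𝔫₀ hk₀, mul_one]
    exact h3

end Data

/-! ### Positivity of the local zeta integral at complex points -/

section LocalZeta

variable {n : ℕ} {K : Type} [Field K] [NumberField K]
  {μ : Measure (AdelicGroupData.gl n K).automorphicQuotient} [(AdelicGroupData.gl n K).IsAutomorphicMeasure μ]
  {T : Finset (HeightOneSpectrum (𝓞 K))}
  [MeasurableSpace (placesFactor K n T)] [BorelSpace (placesFactor K n T)]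
  (μG : Measure (placesFactor K n T)) [μG.IsHaarMeasure]

/-- `Re (c w) > 0` when `c = m - ε` with `‖ε‖ < m / 2` and `Re w > ‖w‖ / 2 > 0`. [folklore] -/
theorem re_mul_pos_of_norm_sub_lt {c w : ℂ} {m : ℝ} (hm : 0 < m) (hc : ‖(m : ℂ) - c‖ < m / 2)
    (hw : ‖w‖ / 2 < w.re) (hw0 : 0 < ‖w‖) : 0 < (c * w).re := by
  have e : c * w = (m : ℂ) * w - ((m : ℂ) - c) * w := by ring
  rw [e, Complex.sub_re, Complex.re_ofReal_mul]
  have h1 : (((m : ℂ) - c) * w).re ≤ ‖(m : ℂ) - c‖ * ‖w‖ :=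
    (Complex.re_le_norm _).trans (norm_mul_le _ _)
  nlinarith [norm_nonneg ((m : ℂ) - c)]

/-- `Re (d^s) > ‖d^s‖ / 2` for real `d > 0` as soon as `|im s · log d| < 1` (`cos θ ≥ 1 - θ²/2`).
[folklore] -/
theorem norm_cpow_div_two_lt_re {d : ℝ} (hd : 0 < d) {s : ℂ} (h : |s.im * Real.log d| < 1) :
    ‖((d : ℂ) ^ s)‖ / 2 < ((d : ℂ) ^ s).re := by
  have hd0 : (d : ℂ) ≠ 0 := Complex.ofReal_ne_zero.2 hd.ne'
  rw [Complex.cpow_def_of_ne_zero hd0, ← Complex.ofReal_log hd.le, Complex.norm_exp, Complex.exp_re,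
    Complex.re_ofReal_mul, Complex.im_ofReal_mul]
  have hcos : 1 / 2 < Real.cos (Real.log d * s.im) := by
    have h1 := Real.one_sub_sq_div_two_le_cos (x := Real.log d * s.im)
    have h2 : (Real.log d * s.im) ^ 2 < 1 := by
      rw [mul_comm, ← sq_abs]
      nlinarith [abs_nonneg (s.im * Real.log d)]
    linarith
  have hexp : 0 < Real.exp (Real.log d * s.re) := Real.exp_pos _
  nlinarith

/-- **Positivity of the local zeta integral on a horizontal line.** If `Ψ` is continuous with values
in `[0, 1]`, `Ψ(1) = 1`, `φ ≠ 0`, and `Ψ` is supported in a compact set on which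
`‖R(a) φ - φ‖ < ‖φ‖ / 2` and `|t · log |det a|_𝔸| < 1`, then `Re Z_T(s) > 0` for every `s` with
`im s = t`: the real part of the integrand `Ψ(a) ⟪φ, R(a) φ⟫ |det a|^s` is a continuous compactly
supported function, non-negative (where `Ψ(a) ≠ 0`: `⟪φ, R(a) φ⟫ = ‖φ‖² - ε`, `|ε| < ‖φ‖²/2`, and
`Re |det a|^s = |det a|^{re s} cos (t log |det a|) > ‖|det a|^s‖ / 2`), positive at `a = 1`, and Haar
measure is positive on opens (the argument of `re_placesZeta_pos`, which is the case `t = 0`).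
[folklore] -/
theorem re_placesZeta_pos_of_im_eq {Ψ : GL (Fin n) (AdeleRing (𝓞 K) K) → ℂ} (hΨc : Continuous Ψ)
    (hΨ01 : ∀ a, ∃ r : ℝ, 0 ≤ r ∧ r ≤ 1 ∧ Ψ a = r) (hΨ1 : Ψ 1 = 1)
    {N : Set (GL (Fin n) (AdeleRing (𝓞 K) K))} (hN : IsCompact N) {φ : (AdelicGroupData.gl n K).L2 μ} (hφ0 : φ ≠ 0)
    {t : ℝ}
    (hsupp : ∀ a : placesFactor K n T, Ψ a ≠ 0 → (a : GL (Fin n) (AdeleRing (𝓞 K) K)) ∈ N ∧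
      ‖(AdelicGroupData.gl n K).rightRegular μ (a : GL (Fin n) (AdeleRing (𝓞 K) K)) φ - φ‖ < ‖φ‖ / 2 ∧
      |t * Real.log (adelicAbsDet n K (a : GL (Fin n) (AdeleRing (𝓞 K) K)) : ℝ)| < 1)
    {s : ℂ} (hs : s.im = t) : 0 < (placesZeta T μG Ψ φ s).re := by
  set d : placesFactor K n T → ℝ := fun a => (adelicAbsDet n K (a : GL (Fin n) (AdeleRing (𝓞 K) K)) : ℝ) with hd
  have hd0 : ∀ a, 0 < d a := fun a => adelicAbsDet_pos _
  -- the integrand and its real part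
  set F : placesFactor K n T → ℂ := fun a => Ψ (a : GL (Fin n) (AdeleRing (𝓞 K) K)) *
    glMatrixCoeff μ φ φ (a : GL (Fin n) (AdeleRing (𝓞 K) K)) * (((d a : ℝ) : ℂ)) ^ s with hF
  set g : placesFactor K n T → ℝ := fun a => (F a).re with hg
  have hFc : Continuous F := continuous_placesZeta_integrand hΨc φ s
  have hF0 : ∀ a : placesFactor K n T, Ψ a = 0 → F a = 0 := fun a h => by
    simp only [hF, h, zero_mul]
  have hint : Integrable F μG := by
    refine hFc.integrable_of_hasCompactSupport ?_
    exact hasCompactSupport_placesFactor hN fun a ha => (hsupp a fun h => ha (hF0 a h)).1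
  have hZ : (placesZeta T μG Ψ φ s).re = ∫ a, g a ∂μG := by
    rw [placesZeta, ← RCLike.re_eq_complex_re, ← integral_re hint]
    exact integral_congr_ae (Filter.Eventually.of_forall fun a => by rw [RCLike.re_eq_complex_re])
  rw [hZ]
  -- positivity of the real part of the integrand on the support
  have hφ : 0 < ‖φ‖ := norm_pos_iff.2 hφ0
  have hpos : ∀ a : placesFactor K n T, Ψ a ≠ 0 → 0 < g a := by
    intro a ha
    obtain ⟨-, hclose, hlog⟩ := hsupp a ha
    obtain ⟨r, hr0, -, hr⟩ := hΨ01 (a : GL (Fin n) (AdeleRing (𝓞 K) K))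
    have hrpos : 0 < r := by
      rcases hr0.lt_or_eq with h | h
      · exact h
      · exact absurd (by rw [hr, ← h, Complex.ofReal_zero]) ha
    -- the coefficient `c = ⟪φ, R(a) φ⟫ = ‖φ‖² - ⟪φ, φ - R(a) φ⟫`
    set v := (AdelicGroupData.gl n K).rightRegular μ (a : GL (Fin n) (AdeleRing (𝓞 K) K)) φ with hv
    have hc : ‖((‖φ‖ ^ 2 : ℝ) : ℂ) - glMatrixCoeff μ φ φ (a : GL (Fin n) (AdeleRing (𝓞 K) K))‖ < ‖φ‖ ^ 2 / 2 := by
      rw [glMatrixCoeff_apply]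
      have e : ((‖φ‖ ^ 2 : ℝ) : ℂ) - ⟪φ, v⟫_ℂ = ⟪φ, φ - v⟫_ℂ := by
        rw [inner_sub_right, inner_self_eq_norm_sq_to_K]
        norm_cast
      rw [e]
      have h1 : ‖⟪φ, φ - v⟫_ℂ‖ ≤ ‖φ‖ * ‖φ - v‖ := norm_inner_le_norm _ _
      have h2 : ‖φ - v‖ < ‖φ‖ / 2 := by rwa [norm_sub_rev]
      nlinarith
    -- the power `w = |det a|^s`
    have hw : ‖(((d a : ℝ) : ℂ)) ^ s‖ / 2 < ((((d a : ℝ) : ℂ)) ^ s).re :=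
      norm_cpow_div_two_lt_re (hd0 a) (by rwa [hs])
    have hw0 : 0 < ‖(((d a : ℝ) : ℂ)) ^ s‖ := by
      rw [Complex.norm_cpow_eq_rpow_re_of_pos (hd0 a)]
      exact Real.rpow_pos_of_pos (hd0 a) _
    have hcw := re_mul_pos_of_norm_sub_lt (pow_pos hφ 2) hc hw hw0
    simp only [hg, hF, hr, mul_assoc, Complex.re_ofReal_mul]
    exact mul_pos hrpos hcw
  have hg0 : 0 ≤ g := by
    intro a
    by_cases ha : Ψ (a : GL (Fin n) (AdeleRing (𝓞 K) K)) = 0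
    · simp only [Pi.zero_apply, hg, hF0 a ha, Complex.zero_re, le_refl]
    · exact (hpos a ha).le
  have hgc : Continuous g := Complex.continuous_re.comp hFc
  have hgs : HasCompactSupport g := by
    refine hasCompactSupport_placesFactor hN fun a ha => (hsupp a fun h => ha ?_).1
    simp only [hg, hF0 a h, Complex.zero_re]
  have hg1 : g 1 ≠ 0 := by
    have h1 : Ψ ((1 : placesFactor K n T) : GL (Fin n) (AdeleRing (𝓞 K) K)) ≠ 0 := by
      rw [OneMemClass.coe_one, hΨ1]
      exact one_ne_zero
    exact (hpos 1 h1).ne'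
  exact hgc.integral_pos_of_hasCompactSupport_nonneg_nonzero hgs hg0 hg1

end LocalZeta

end Summit.Langlands.Langlands.Theorems.DedekindQuotient1951

end
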